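import Summits.HodgeConjecture.HodgeConjecture.Theorems.VHCAbelianSchemesRoadRegimeAdditiveKernel
import HarnessLib

/-!
# Road b02 (`VHCAbelianSchemesRoad`, D-0059) — THE DIAGONAL ENGINE ON THE PER-PENCIL CONCLUSION:
# `LocusNotCountableAtDeg n p` (node (U) at `(n, p)`) and node (U) / row b02 / `HC_AV` from its DIAGONAL `(2m, m)`

research route conditional on HC_CM; not a corollary; Q11.4-sentence-2 already refuted in dim ≥ 3.
(cell line of seat ab-andre-2: research route, not a corollary; conditional on HC_CM plus one named minimal statement.)

THEOREMS + one `@[conjecture]` predicate; no named fact, no sorry; `HC_CM` occurs nowhere. Seat ab-andre-2 gen 66 (follow-up of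
K-ADD, director-hodge R11.3; helper `--supports stmt-HodgeConjecture-20707`). The route file, its `closes` glue, the binders of record
and the skeleton are NOT touched.

WHY. The diagonal engine of `VHCAbelianSchemesRoadDiagonal.lean` §3–§4 (lower shadow, middle lift of the padded pencil, the class
target `HCUpToDim G`) was run twice — for the single-datum graded crux (`…_of_lefAtDeg_diagonal`) and for its additive twin
(`…_of_lefAtDegAdd_diagonal`, `VHCAbelianSchemesRoadRegimeAdditiveKernel.lean`) — although it consumes the crux and the door ONLY
through the per-pencil conclusion «the algebraicity locus of `W` on this pencil is not countable». This file names that conclusion,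
graded by `(n, p)` — `LocusNotCountableAtDeg n p`, the `(n, p)`-slice of node (U) `Ring2.Binders.OneParameterAbelianSchemeVHCUncountable`
(`locusNotCountableAtDeg_forall_iff`) — and runs the engine ONCE on it, so that every present or future form of the crux (single,
additive, local-in-the-fibre, …) only has to supply `door + crux(n, p) ⟹ LocusNotCountableAtDeg n p`:
* §1 the predicate; `∀ n p` ⟺ node (U); feeders from the single-datum graded crux, from its additive twin (+ door) and from row b02.
* §2 the engine: `not_countable_algebraicityLocus_of_locus_diagonal_of_lowerHalf`, `…_of_locus_diagonal` (copies of Diagonal §3 with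
  the per-pencil lemma replaced by the predicate), node (U) from `HCUpToDim G` + the diagonal `2m > G`, fact-free from `m ≥ 2`
  (`hcUpToDim_three`), from `m ≥ 3` granted `HCUpToDim 5`; row b02 and `HC_AV` (André #21/#22) from the same.

NOT claimed: any cell of any regime; anything about `HC_CM`. References: [BrosnanFangNiePearlstein2009] §6 Lemma 48; [Lieberman1968];
[KerrPearlstein2011] §3.1; [CharlesSchnell2014Notes] Conj. 11.3.1, Prop. 11.3.11, Cor. 11.3.6; [Grothendieck1966] footnote 13;
[Markman2025SurveySecant] Cor. 1.3; [Andre1996Motifs] §6.3; [GortzWedhorn2023] Thm. 27.291; [VoisinHodgeII2003] §10.2.3.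
-/

noncomputable section

open CategoryTheory CategoryTheory.Limits AlgebraicGeometry Topology MonoidalCategory CartesianMonoidalCategory

namespace Summit.HodgeConjecture.HodgeConjecture.Ring2.SemiregularRepresentatives

set_option linter.dupNamespace false -- the cell's namespace repeats the summit name, as in every `Ring2*` file

open Literature.AlgebraicGeometry Literature.AlgebraicGeometry.Motives Literature.AlgebraicGeometry.HodgeTheory
open Literature.AlgebraicTopology.SingularHomology
open Literature.AlgebraicGeometry.Andre1996 (andre1996_cmAnchoredPencil
  andre1996_cmHodgeClasses_algebraicallyAnchoredPencils)
open Summit.Ventures.HSemireg (ObjClass LocalVariationalHodgeFor)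
open Summit.HodgeConjecture.HodgeConjecture.Ring2.Hypotheses (AbelianSchemeVHC)
open Summit.HodgeConjecture.HodgeConjecture.Ring2.Binders
open Summit.HodgeConjecture.HodgeConjecture.Ring2.ClassTargets

/-! ## §1 Node (U) at `(n, p)`: the per-pencil conclusion every crux form feeds -/

/-- **`LocusNotCountableAtDeg n p` — node (U) AT relative dimension `n` and codimension `p`**: the body of
`Ring2.Binders.OneParameterAbelianSchemeVHCUncountable` with `n` and `p` FIXED (binders promoted to parameters, nothing else changed):
on every one-parameter abelian scheme of relative dimension `n` over a smooth irreducible affine curve with a section and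
quasi-projective total space, a fibrewise rational `(p,p)` global class algebraic on one fibre has a NOT COUNTABLE algebraicity
locus. `∀ n p` ⟺ node (U) (`locusNotCountableAtDeg_forall_iff`). The conclusion the diagonal engine consumes; supplied by «door +
crux at `(n, p)`» for every form of the crux (§1 feeders). OPEN; a HYPOTHESIS wherever used.
[cite: Grothendieck1966, footnote 13] [cite: CharlesSchnell2014Notes, Conj. 11.3.1 and Prop. 11.3.11 (proof)] -/
@[conjecture] def LocusNotCountableAtDeg (n p : ℕ) : Prop :=
  ∀ ⦃𝒳 S : SchemeOver ℂ⦄ (f : 𝒳 ⟶ S), IsSmoothProjectiveFamily f n → IsQuasiProjectiveOver 𝒳 →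
    IrreducibleSpace S.left → IsAffine S.left → AlgebraicGeometry.Smooth S.hom → topologicalKrullDim S.left = 1 →
    (∀ s : ComplexPoints S, ∃ A' : AbelianVariety ℂ, A'.dim = n ∧ Nonempty (A'.X ≅ fiberOver f s)) →
    (∃ e : S ⟶ 𝒳, e ≫ f = 𝟙 S) →
    ∀ (W : complexBetti 𝒳 (2 * p)),
      (∀ s : ComplexPoints S, IsRationalClass (complexBetti.map (fiberι f s) (2 * p) W) ∧
        IsOfHodgeType n (fiberOver f s) (2 * p) p p (complexBetti.map (fiberι f s) (2 * p) W)) →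
      ∀ s₀ : ComplexPoints S,
        complexBetti.map (fiberι f s₀) (2 * p) W ∈ algebraicClasses (fiberOver f s₀) p →
        ¬ {s : ComplexPoints S |
            complexBetti.map (fiberι f s) (2 * p) W ∈ algebraicClasses (fiberOver f s) p}.Countable

/-- **`(∀ n p, LocusNotCountableAtDeg n p) ⟺ node (U)`** (reorder the binders). [folklore] -/
theorem locusNotCountableAtDeg_forall_iff :
    (∀ n p : ℕ, LocusNotCountableAtDeg n p) ↔ OneParameterAbelianSchemeVHCUncountable :=
  ⟨fun h n _ _ f hf h𝒳 hirr haff hsm hdim habel he p W hW s₀ hs₀ =>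
      h n p f hf h𝒳 hirr haff hsm hdim habel he W hW s₀ hs₀,
    fun h _ p _ _ f hf h𝒳 hirr haff hsm hdim habel he W hW s₀ hs₀ =>
      h f hf h𝒳 hirr haff hsm hdim habel he p W hW s₀ hs₀⟩

variable {𝒪 : ObjClass} {n p : ℕ}

/-- **Feeder (single datum)**: the door + K-SR♭∃ at `(n, p)` ⟹ node (U) at `(n, p)` (`not_countable_algebraicityLocus_of_lefAtDeg`).
[cite: BuchweitzFlenner2003, §5 Thm. 5.1] [cite: CharlesSchnell2014Notes, Prop. 11.3.11 (proof)] -/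
theorem locusNotCountableAtDeg_of_lefAtDeg (hT : LocalVariationalHodgeFor 𝒪) (hSR : AdmissibleRepresentativesLefAtDeg 𝒪 n p) :
    LocusNotCountableAtDeg n p := by
  intro 𝒳 S f hf h𝒳 hirr haff hsm hdim habel he W hW s₀ hs₀
  haveI := hirr; haveI := haff; haveI := hsm
  exact not_countable_algebraicityLocus_of_lefAtDeg hT hSR f hf h𝒳 hdim habel he W hW hs₀

/-- **Feeder (additive data)**: the door + the ADDITIVE graded crux at `(n, p)` ⟹ node (U) at `(n, p)`
(`not_countable_algebraicityLocus_of_lefAtDegAdd`). [cite: BuchweitzFlenner2003, §5 Thm. 5.1]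
[cite: CharlesSchnell2014Notes, Prop. 11.3.11 (proof)] -/
theorem locusNotCountableAtDeg_of_lefAtDegAdd (hT : LocalVariationalHodgeFor 𝒪)
    (hSR : AdmissibleRepresentativesLefAtDegAdd 𝒪 n p) : LocusNotCountableAtDeg n p := by
  intro 𝒳 S f hf h𝒳 hirr haff hsm hdim habel he W hW s₀ hs₀
  haveI := hirr; haveI := haff; haveI := hsm
  exact not_countable_algebraicityLocus_of_lefAtDegAdd hT hSR f hf h𝒳 hdim habel he W hW hs₀

/-- **Feeder (additive regime 2)**: the door + additive regime 2 at `(n, p)` ⟹ node (U) at `(n, p)` (regime 1 is datum-free).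
[cite: vanGeemen1994HodgeAV, §2.4] [cite: BuchweitzFlenner2003, §5 Thm. 5.1] -/
theorem locusNotCountableAtDeg_of_exceptionalRegimeAtAdd (hT : LocalVariationalHodgeFor 𝒪)
    (h₂ : LefAtExceptionalRegimeAtAdd 𝒪 n p) : LocusNotCountableAtDeg n p :=
  locusNotCountableAtDeg_of_lefAtDegAdd hT (admissibleRepresentativesLefAtDegAdd_of_regimeAdd h₂)

/-- **Feeder (row b02)**: `AbelianSchemeVHC ⟹ node (U)` at every `(n, p)` — the ON-PATH direction (the node is a CASE of the row).
[cite: CharlesSchnell2014Notes, Conj. 11.3.1] -/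
theorem locusNotCountableAtDeg_of_abelianSchemeVHC (h : AbelianSchemeVHC) (n p : ℕ) : LocusNotCountableAtDeg n p :=
  locusNotCountableAtDeg_forall_iff.2 (oneParameterAbelianSchemeVHCUncountable_of_abelianSchemeVHC h) n p

/-! ## §2 The engine on the predicate: node (U), row b02 and `HC_AV` from the DIAGONAL `(2m, m)` -/

variable {𝒳 S : SchemeOver ℂ}

/-- **Node (U) at `(n, p)` from its DIAGONAL cells above `G`, per pencil** (`G < n`, `2p ≤ n`): pad by an abelian variety of
dimension `n − 2p`, middle lift (same algebraicity locus) — `VHCAbelianSchemesRoadDiagonal` §3 with the per-pencil lemma replaced by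
the predicate. [cite: BrosnanFangNiePearlstein2009, §6 Lemma 48] [cite: Lieberman1968, main theorem] -/
theorem not_countable_algebraicityLocus_of_locus_diagonal_of_lowerHalf
    {G : ℕ} (hL : ∀ m : ℕ, G < 2 * m → LocusNotCountableAtDeg (2 * m) m)
    (f : 𝒳 ⟶ S) {n : ℕ} (hf : IsSmoothProjectiveFamily f n) (hGn : G < n) (h𝒳 : IsQuasiProjectiveOver 𝒳)
    [IrreducibleSpace S.left] [IsAffine S.left] [AlgebraicGeometry.Smooth S.hom] (hdim : topologicalKrullDim S.left = 1)
    (habel : ∀ s : ComplexPoints S, ∃ A' : AbelianVariety ℂ, A'.dim = n ∧ Nonempty (A'.X ≅ fiberOver f s))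
    (he : ∃ e : S ⟶ 𝒳, e ≫ f = 𝟙 S) {p : ℕ} (hpn : 2 * p ≤ n) (W : complexBetti 𝒳 (2 * p))
    (hW : ∀ s : ComplexPoints S, IsRationalClass (complexBetti.map (fiberι f s) (2 * p) W) ∧
      IsOfHodgeType n (fiberOver f s) (2 * p) p p (complexBetti.map (fiberι f s) (2 * p) W))
    {s₀ : ComplexPoints S} (hs₀ : complexBetti.map (fiberι f s₀) (2 * p) W ∈ algebraicClasses (fiberOver f s₀) p) :
    ¬ {s : ComplexPoints S |
        complexBetti.map (fiberι f s) (2 * p) W ∈ algebraicClasses (fiberOver f s) p}.Countable := by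
  haveI : LocallyOfFiniteType S.hom := inferInstance
  haveI : IsSeparated S.hom := (IsQuasiProjectiveOver.of_isAffine S).isSeparated
  rcases Nat.eq_or_lt_of_le hpn with hmid | hlt
  · subst hmid
    exact hL p hGn f hf h𝒳 ‹_› ‹_› ‹_› hdim habel he W hW s₀ hs₀
  · obtain ⟨B, hB⟩ := exists_abelianVariety_dim_eq_succ ℂ (n - 2 * p - 1)
    have hpB : 2 * p + B.dim = n := by omega
    obtain ⟨hf', habel', W', hW', hiff⟩ := exists_middleLift f hf h𝒳 habel B hpB W hW
    have hmid : n + B.dim = 2 * (p + B.dim) := by omega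
    rw [hmid] at hf' habel' hW'
    have h := hL (p + B.dim) (by omega) (fst 𝒳 B.X ≫ f) hf'
      (isQuasiProjectiveOver_tensor h𝒳 (AbelianVariety.isSmoothProjective_holds (A := B)).isProjectiveOver) ‹_› ‹_› ‹_› hdim
      habel' (exists_section_fst_comp f he B) W' hW' s₀ ((hiff s₀).2 hs₀)
    have hset : {s : ComplexPoints S | complexBetti.map (fiberι (fst 𝒳 B.X ≫ f) s) (2 * (p + B.dim)) W' ∈
          algebraicClasses (fiberOver (fst 𝒳 B.X ≫ f) s) (p + B.dim)} =
        {s : ComplexPoints S | complexBetti.map (fiberι f s) (2 * p) W ∈ algebraicClasses (fiberOver f s) p} :=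
      Set.ext fun s => hiff s
    rwa [hset] at h

/-- **Node (U) at `(n, p)` from the DIAGONAL cells above `G`, per pencil, EVERY `p`** (`G < n`): no non-zero `(p,p)`-classes
for `p > n`; the lower shadow above the middle; then padding — `VHCAbelianSchemesRoadDiagonal` §3 on the predicate.
[cite: KerrPearlstein2011, §3.1] [cite: Lieberman1968, main theorem] [cite: BrosnanFangNiePearlstein2009, §6 Lemma 48] -/
theorem not_countable_algebraicityLocus_of_locus_diagonal
    {G : ℕ} (hL : ∀ m : ℕ, G < 2 * m → LocusNotCountableAtDeg (2 * m) m)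
    (f : 𝒳 ⟶ S) {n : ℕ} (hf : IsSmoothProjectiveFamily f n) (hGn : G < n) (h𝒳 : IsQuasiProjectiveOver 𝒳)
    [IrreducibleSpace S.left] [IsAffine S.left] [AlgebraicGeometry.Smooth S.hom] (hdim : topologicalKrullDim S.left = 1)
    (habel : ∀ s : ComplexPoints S, ∃ A' : AbelianVariety ℂ, A'.dim = n ∧ Nonempty (A'.X ≅ fiberOver f s))
    (he : ∃ e : S ⟶ 𝒳, e ≫ f = 𝟙 S) (p : ℕ) (W : complexBetti 𝒳 (2 * p))
    (hW : ∀ s : ComplexPoints S, IsRationalClass (complexBetti.map (fiberι f s) (2 * p) W) ∧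
      IsOfHodgeType n (fiberOver f s) (2 * p) p p (complexBetti.map (fiberι f s) (2 * p) W))
    {s₀ : ComplexPoints S} (hs₀ : complexBetti.map (fiberι f s₀) (2 * p) W ∈ algebraicClasses (fiberOver f s₀) p) :
    ¬ {s : ComplexPoints S |
        complexBetti.map (fiberι f s) (2 * p) W ∈ algebraicClasses (fiberOver f s) p}.Countable := by
  haveI : LocallyOfFiniteType S.hom := inferInstance
  by_cases hpn : 2 * p ≤ n
  · exact not_countable_algebraicityLocus_of_locus_diagonal_of_lowerHalf hL f hf hGn h𝒳 hdim habel he hpn W hW hs₀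
  by_cases hnp : n < p
  · have huniv : {s : ComplexPoints S |
        complexBetti.map (fiberι f s) (2 * p) W ∈ algebraicClasses (fiberOver f s) p} = Set.univ :=
      Set.eq_univ_of_forall fun s => by
        rw [Set.mem_setOf_eq, (hW s).2.eq_zero_pp_of_lt hnp]
        exact Submodule.zero_mem _
    rw [huniv]
    exact not_countable_of_isOpen_of_curve hdim isOpen_univ ⟨s₀, Set.mem_univ _⟩
  · obtain ⟨q, j, hqj, hp⟩ : ∃ q j : ℕ, 2 * q + j = n ∧ q + j = p := ⟨n - p, 2 * p - n, by omega, by omega⟩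
    subst hp
    obtain ⟨W', hW', hiff⟩ := exists_lowerShadow f hf h𝒳 (IsQuasiProjectiveOver.of_isAffine S) ‹_› habel hqj W hW
    have h := not_countable_algebraicityLocus_of_locus_diagonal_of_lowerHalf hL f hf hGn h𝒳 hdim habel he (by omega) W'
      hW' ((hiff s₀).2 hs₀)
    have hset : {s : ComplexPoints S | complexBetti.map (fiberι f s) (2 * q) W' ∈ algebraicClasses (fiberOver f s) q} =
        {s : ComplexPoints S | complexBetti.map (fiberι f s) (2 * (q + j)) W ∈
          algebraicClasses (fiberOver f s) (q + j)} :=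
      Set.ext fun s => hiff s
    rwa [hset] at h

/-- **Node (U) from the class target `HCUpToDim G` and node (U) ON THE DIAGONAL `(2m, m)`, `2m > G`.**
[cite: CharlesSchnell2014Notes, Conj. 11.3.1 and Prop. 11.3.11 (proof)] [cite: BrosnanFangNiePearlstein2009, §6 Lemma 48]
[cite: Lieberman1968, main theorem] -/
theorem oneParameterAbelianSchemeVHCUncountable_of_hcUpToDim_of_locus_diagonal {G : ℕ} (hG : HCUpToDim G)
    (hL : ∀ m : ℕ, G < 2 * m → LocusNotCountableAtDeg (2 * m) m) : OneParameterAbelianSchemeVHCUncountable := by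
  intro n 𝒳 S f hf h𝒳 hirr haff hsm hdim habel he p W hW s₀ hs₀
  haveI := hirr
  haveI := haff
  haveI := hsm
  rcases Nat.lt_or_ge G n with hGn | hnG
  · exact not_countable_algebraicityLocus_of_locus_diagonal hL f hf hGn h𝒳 hdim habel he p W hW hs₀
  · exact not_countable_algebraicityLocus_of_hcUpToDim hG f hnG hdim habel p W hW s₀

/-- **Node (U) ⟺ node (U) on the diagonal `(2m, m)`, `m ≥ 2`** — FACT-FREE (relative dimension `≤ 3` is unconditional,
`hcUpToDim_three`): the whole `(n, p)`-table of node (U) is carried by its diagonal. [cite: VoisinHodgeII2003, §10.2.3 proof of Prop. 10.26]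
[cite: BrosnanFangNiePearlstein2009, §6 Lemma 48] [cite: Lieberman1968, main theorem] -/
theorem oneParameterAbelianSchemeVHCUncountable_iff_locus_diagonal_two :
    OneParameterAbelianSchemeVHCUncountable ↔ ∀ m : ℕ, 2 ≤ m → LocusNotCountableAtDeg (2 * m) m :=
  ⟨fun h m _ => locusNotCountableAtDeg_forall_iff.2 h (2 * m) m,
    fun h => oneParameterAbelianSchemeVHCUncountable_of_hcUpToDim_of_locus_diagonal hcUpToDim_three
      fun m hm => h m (by omega)⟩

/-- **Node (U) from `HCUpToDim 5`** (Markman 2025 Cor. 1.3, UNREFEREED — the support item `HodgeAbelianDimLeFive`) **and node (U) on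
the diagonal `(2m, m)`, `m ≥ 3`.** [cite: Markman2025SurveySecant, Cor. 1.3] [cite: BrosnanFangNiePearlstein2009, §6 Lemma 48] -/
theorem oneParameterAbelianSchemeVHCUncountable_of_hcUpToDim_five_of_locus_diagonal_three (h₅ : HCUpToDim 5)
    (hL : ∀ m : ℕ, 3 ≤ m → LocusNotCountableAtDeg (2 * m) m) : OneParameterAbelianSchemeVHCUncountable :=
  oneParameterAbelianSchemeVHCUncountable_of_hcUpToDim_of_locus_diagonal h₅ fun m hm => hL m (by omega)

/-- **Row b02 from node (U) on the diagonal `m ≥ 2` and the curve residual — no class target.**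
[cite: CharlesSchnell2014Notes, Prop. 11.3.11 (proof)] [cite: GortzWedhorn2023, Thm. 27.291] -/
theorem abelianSchemeVHC_of_locus_diagonal_two (hL : ∀ m : ℕ, 2 ≤ m → LocusNotCountableAtDeg (2 * m) m)
    (hqp : OneParameterAbelianSchemeQuasiProjective) : AbelianSchemeVHC :=
  abelianSchemeVHC_of_uncountable_of_oneParameterAbelianSchemeQuasiProjective hqp
    (oneParameterAbelianSchemeVHCUncountable_iff_locus_diagonal_two.2 hL)

/-- **Row b02 ⟺ node (U) on the diagonal `m ≥ 2`, modulo the curve residual.** [cite: CharlesSchnell2014Notes, Prop. 11.3.11 (proof)]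
[cite: GortzWedhorn2023, Thm. 27.291] -/
theorem abelianSchemeVHC_iff_locus_diagonal_two (hqp : OneParameterAbelianSchemeQuasiProjective) :
    AbelianSchemeVHC ↔ ∀ m : ℕ, 2 ≤ m → LocusNotCountableAtDeg (2 * m) m :=
  ⟨fun h m _ => locusNotCountableAtDeg_of_abelianSchemeVHC h (2 * m) m, fun h => abelianSchemeVHC_of_locus_diagonal_two h hqp⟩

/-- **Row b02 from `HCUpToDim 5`, node (U) on the diagonal `m ≥ 3` and the curve residual.**
[cite: CharlesSchnell2014Notes, Prop. 11.3.11 (proof)] [cite: Markman2025SurveySecant, Cor. 1.3] [cite: GortzWedhorn2023, Thm. 27.291] -/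
theorem abelianSchemeVHC_of_hcUpToDim_five_of_locus_diagonal_three (h₅ : HCUpToDim 5)
    (hL : ∀ m : ℕ, 3 ≤ m → LocusNotCountableAtDeg (2 * m) m) (hqp : OneParameterAbelianSchemeQuasiProjective) :
    AbelianSchemeVHC :=
  abelianSchemeVHC_of_uncountable_of_oneParameterAbelianSchemeQuasiProjective hqp
    (oneParameterAbelianSchemeVHCUncountable_of_hcUpToDim_five_of_locus_diagonal_three h₅ hL)

/-- **`HC_AV` from node (U) on the DIAGONAL `(2m, m)`, `m ≥ 2`, the curve residual and André 1996 #21/#22 — no class target, no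
`HC_CM`.** [cite: Andre1996Motifs, §6.3 Lemmes 6.3.1–6.3.3 and Remarque 2 (p. 33)] [cite: BrosnanFangNiePearlstein2009, §6 Lemma 48] -/
theorem hc_av_of_locus_diagonal_two (hL : ∀ m : ℕ, 2 ≤ m → LocusNotCountableAtDeg (2 * m) m)
    (hqp : OneParameterAbelianSchemeQuasiProjective) (h₂₁ : andre1996_cmAnchoredPencil)
    (h₂₂ : andre1996_cmHodgeClasses_algebraicallyAnchoredPencils) :
    Theses.PadicSemiregularLift.HodgeAbelianVarieties :=
  (Ring2.Deform.HC_AV_iff_abelianSchemeVHC_of_andre1996 h₂₁ h₂₂).mpr (abelianSchemeVHC_of_locus_diagonal_two hL hqp)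

/-- **`HC_AV` from `HCUpToDim 5`, node (U) on the DIAGONAL `(2m, m)`, `m ≥ 3`, the curve residual and André 1996 #21/#22.**
[cite: Andre1996Motifs, §6.3 Lemmes 6.3.1–6.3.3 and Remarque 2 (p. 33)] [cite: Markman2025SurveySecant, Cor. 1.3] -/
theorem hc_av_of_hcUpToDim_five_of_locus_diagonal_three (h₅ : HCUpToDim 5)
    (hL : ∀ m : ℕ, 3 ≤ m → LocusNotCountableAtDeg (2 * m) m) (hqp : OneParameterAbelianSchemeQuasiProjective)
    (h₂₁ : andre1996_cmAnchoredPencil) (h₂₂ : andre1996_cmHodgeClasses_algebraicallyAnchoredPencils) :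
    Theses.PadicSemiregularLift.HodgeAbelianVarieties :=
  (Ring2.Deform.HC_AV_iff_abelianSchemeVHC_of_andre1996 h₂₁ h₂₂).mpr
    (abelianSchemeVHC_of_hcUpToDim_five_of_locus_diagonal_three h₅ hL hqp)

end Summit.HodgeConjecture.HodgeConjecture.Ring2.SemiregularRepresentatives

end
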